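import Summits.Ventures.LatticeQCDFlow.Scaling.UrnProductCertificate

/-!
HONEST FRAMING: exact (Metropolis-corrected) sampling algorithms for lattice gauge theory; figures
of merit are autocorrelation/cost numbers at stated couplings and volumes; no continuum-physics
claim.

# StarHubChainFirstOrder — THE ONE-COPY HUB CHAIN OF THE STAR AS A STOCHASTIC MATRIX ON ALL CONTENTS, ITS LEGALITY, THE ACCEPTANCE FLOOR `acc(h,v) ≥ pW_h`, THE KEY
# INEQUALITY `acc(h,v)(1 − θ_v) ≤ pW_h·θ_v`, AND THE FIRST-ORDER BOUNDS OF MEMO-gen35 §7: ONE ATTEMPT MOVES `E θ(hub)` BY AT LEAST `A_h(1−θ_h) − (pW_h/K)·m_h`, AND THE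
# ONE-ATTEMPT GAIN OF TWO COPIES WITH A COMMON HUB IS `min{S_A,S_B}/K`, `S_B/K`, `S_A/K` (hub content common, `X`-surplus, `Y`-surplus) `≥ pW_z·Δ/K` (lean-2 GEN-36, ours)

Venture-side (OURS).  Cell `lqcd-flow` (pub-lqcd), unit `pub-lqcd-lean-2-g36`, 2026-08-29.  Chapter W (item 1 (i) at finite swap odds), file 4.  Setting of chapter V: contents `S`,
persistence `W = μ_1/μ_0 > 0` with `p·W ≤ 1`, `θ_v = 1/(1 + pW_v)`, acceptance `acc(h,v) = min{1, W_h/W_v}` of the swap hub `h` ↔ level `v`; a copy with full composition `N`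
(`Σ N = K+1`) and hub `h` has the hub chain `K_N(h,v) = (N_v/K)·acc(h,v)` (`v ≠ h`), diagonal completing the row (`Scaling/HubChainDetailedBalance`); here the rows of
contents absent from `N` are set to the identity so that `K_N` is a stochastic matrix on all of `S` (the resolvent of `Scaling/ResolventLaw` never visits them:
`starHub_closed`).  PROVED: `K_N ≥ 0`, rows one, legality is closed; `pW_h ≤ acc(h,v) ≤ 1`; the key inequality `acc(h,v)·(1 − θ_v) ≤ pW_h·θ_v` (equivalently
`θ_v(pW_h + acc) ≥ acc`: `W_h ≥ min{W_h,W_v}`); hence the ONE-ATTEMPT DRIFT of the hub weight `(K_Nθ)(h) − θ_h ≥ A_h(1 − θ_h) − (pW_h/K)·Σ_{v≠h} N_vθ_v`, `A_h = Σ_{v≠h} K_N(h,v)`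
the acceptance probability; and for two copies `N_X`, `N_Y` (`Σ N_X = Σ N_Y`) with a common legal hub `z` the ONE-ATTEMPT GAIN of `Scaling/CycleEndHubBracket` in closed form,
`G(K_X(z,·),K_Y(z,·)) = [z∈C]·min{S_A,S_B}/K + [z∈A]·S_B/K + [z∈B]·S_A/K` with `S_A = Σ_{a∈A∖z}(N_X−N_Y)(a)acc(z,a)`, `S_B = Σ_{b∈B∖z}(N_Y−N_X)(b)acc(z,b)`, and its floor
`G ≥ pW_z·Δ/K`.  Hypothesis-equations, no definitions.

## What is proved

* §1 `starHub_acc_le_one`, `starHub_acc_ge`, `starHub_acc_nonneg`, **`starHub_theta_acc_key`**, `starHub_offDiag_nonneg`, `starHub_offDiag_sum_le`, **`starHub_nonneg`**,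
  **`starHub_rowsum`**, **`starHub_closed`**.
* §2 **`starHub_theta_drift_ge`** (`(K_Nθ)(h) − θ_h ≥ A_h(1−θ_h) − (pW_h/K)·Σ_{v≠h}N_vθ_v`), `starHub_theta_drift_ge'` (`≥ −(pW_h/K)·Σ_{v≠h}N_vθ_v`).
* §3 `starHub_oneStep_diff` (`K_X(z,w) − K_Y(z,w) = ((N_X−N_Y)(w)/K)·acc(z,w)`, `w ≠ z`), **`starHub_oneStep_gain_eq`** (the closed form), **`starHub_oneStep_gain_ge`**
  (`G ≥ pW_z·Δ/K`).

Reading (no numerics implied): the first-order skeleton of MEMO-gen35 §7, typed; by `Scaling/ResolventLaw` and `Scaling/ResolventPairCoupling` these one-step facts are the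
`σ`-independent inputs of any finite-odds certificate.  NOT CLAIMED: a certificate.  Literature grade (cell rule): OWN, elementary; nothing cited as a fact; no new bib keys.
-/

open Finset

namespace Summit.Ventures.LatticeQCDFlow.Scaling

section StarHub
variable {S : Type*} [Fintype S] [DecidableEq S]
variable {W θ : S → ℝ} {acc : S → S → ℝ} {p : ℝ} {K : ℕ}

/-! ## §1 The hub chain on all contents -/

omit [Fintype S] [DecidableEq S] in
/-- `acc(h,v) ≤ 1`. [ours] -/
theorem starHub_acc_le_one (hacc : ∀ h v, acc h v = min 1 (W h / W v)) (h v : S) : acc h v ≤ 1 := by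
  rw [hacc]; exact min_le_left _ _

omit [Fintype S] [DecidableEq S] in
/-- `acc(h,v) ≥ 0`. [ours] -/
theorem starHub_acc_nonneg (hW : ∀ v, 0 < W v) (hacc : ∀ h v, acc h v = min 1 (W h / W v)) (h v : S) : 0 ≤ acc h v := by
  rw [hacc]; exact le_min zero_le_one (div_nonneg (hW h).le (hW v).le)

omit [Fintype S] [DecidableEq S] in
/-- **The acceptance floor:** `acc(h,v) ≥ p·W_h` (`p·W_v ≤ 1`). [ours] -/
theorem starHub_acc_ge (hW : ∀ v, 0 < W v) (hp : ∀ v, p * W v ≤ 1) (hacc : ∀ h v, acc h v = min 1 (W h / W v)) (h v : S) :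
    p * W h ≤ acc h v := by
  rw [hacc]
  refine le_min (hp h) ?_
  rw [le_div_iff₀ (hW v)]
  calc p * W h * W v = W h * (p * W v) := by ring
    _ ≤ W h * 1 := mul_le_mul_of_nonneg_left (hp v) (hW h).le
    _ = W h := mul_one _

omit [Fintype S] [DecidableEq S] in
/-- **THE KEY INEQUALITY:** `acc(h,v)·(1 − θ_v) ≤ p·W_h·θ_v`, i.e. `θ_v·(pW_h + acc(h,v)) ≥ acc(h,v)` (because `W_h ≥ min{W_h, W_v}`). [ours] -/
theorem starHub_theta_acc_key (hW : ∀ v, 0 < W v) (hp0 : 0 ≤ p) (hθ : ∀ v, θ v = 1 / (1 + p * W v)) (hacc : ∀ h v, acc h v = min 1 (W h / W v)) (h v : S) :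
    acc h v * (1 - θ v) ≤ p * W h * θ v := by
  have hWv := hW v; have hWh := hW h
  have hden : 0 < 1 + p * W v := by nlinarith [mul_nonneg hp0 hWv.le]
  have h1 : 1 - θ v = p * W v * θ v := by rw [hθ v]; field_simp; ring
  have hθ0 : 0 ≤ θ v := by rw [hθ v]; positivity
  rw [h1]
  -- `acc·pW_v ≤ pW_h`: `acc·W_v = min{W_v, W_h} ≤ W_h`
  have h2 : acc h v * W v ≤ W h := by
    rw [hacc]
    rcases le_total 1 (W h / W v) with hle | hle
    · rw [min_eq_left hle, one_mul]; rwa [one_le_div hWv] at hle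
    · rw [min_eq_right hle, div_mul_cancel₀ _ (ne_of_gt hWv)]
  calc acc h v * (p * W v * θ v) = (acc h v * W v) * (p * θ v) := by ring
    _ ≤ W h * (p * θ v) := mul_le_mul_of_nonneg_right h2 (mul_nonneg hp0 hθ0)
    _ = p * W h * θ v := by ring

variable {N : S → ℕ} {Kh : S → S → ℝ}

omit [Fintype S] [DecidableEq S] in
/-- Off-diagonal entries are non-negative. [ours] -/
theorem starHub_offDiag_nonneg (hW : ∀ v, 0 < W v) (hacc : ∀ h v, acc h v = min 1 (W h / W v))
    (hKoff : ∀ h v, h ≠ v → Kh h v = if N h = 0 then 0 else (N v : ℝ) / K * acc h v) {h v : S} (hhv : h ≠ v) : 0 ≤ Kh h v := by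
  rw [hKoff h v hhv]
  split_ifs
  · exact le_rfl
  · exact mul_nonneg (div_nonneg (Nat.cast_nonneg _) (Nat.cast_nonneg _)) (starHub_acc_nonneg hW hacc h v)

/-- The off-diagonal row mass is at most one (`Σ N = K+1`, `K ≥ 1`). [ours] -/
theorem starHub_offDiag_sum_le (hacc : ∀ h v, acc h v = min 1 (W h / W v))
    (hKoff : ∀ h v, h ≠ v → Kh h v = if N h = 0 then 0 else (N v : ℝ) / K * acc h v) (hK : 1 ≤ K) (hsum : ∑ v, N v = K + 1) (h : S) :
    ∑ v ∈ univ.erase h, Kh h v ≤ 1 := by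
  by_cases hN : N h = 0
  · rw [sum_eq_zero fun v hv => by rw [hKoff h v (ne_of_mem_erase hv).symm, if_pos hN]]; exact zero_le_one
  · have hK0 : (0 : ℝ) < K := by exact_mod_cast hK
    have hNh : (1 : ℝ) ≤ N h := by exact_mod_cast Nat.one_le_iff_ne_zero.mpr hN
    calc ∑ v ∈ univ.erase h, Kh h v ≤ ∑ v ∈ univ.erase h, (N v : ℝ) / K := by
          refine sum_le_sum fun v hv => ?_
          rw [hKoff h v (ne_of_mem_erase hv).symm, if_neg hN]
          calc (N v : ℝ) / K * acc h v ≤ (N v : ℝ) / K * 1 :=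
                mul_le_mul_of_nonneg_left (starHub_acc_le_one hacc h v) (div_nonneg (Nat.cast_nonneg _) hK0.le)
            _ = (N v : ℝ) / K := mul_one _
      _ = ((∑ v, (N v : ℝ)) - N h) / K := by
          rw [← sum_div, ← Finset.sum_erase_add univ (fun v => (N v : ℝ)) (mem_univ h)]; ring
      _ = ((K + 1 : ℝ) - N h) / K := by congr 1; rw [← Nat.cast_sum, hsum]; push_cast; ring
      _ ≤ 1 := by rw [div_le_one hK0]; linarith

/-- **`K_N ≥ 0`** (the diagonal completes the row). [ours] -/
theorem starHub_nonneg (hW : ∀ v, 0 < W v) (hacc : ∀ h v, acc h v = min 1 (W h / W v))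
    (hKoff : ∀ h v, h ≠ v → Kh h v = if N h = 0 then 0 else (N v : ℝ) / K * acc h v) (hKdiag : ∀ h, Kh h h = 1 - ∑ v ∈ univ.erase h, Kh h v)
    (hK : 1 ≤ K) (hsum : ∑ v, N v = K + 1) (h v : S) : 0 ≤ Kh h v := by
  by_cases hhv : h = v
  · subst hhv; rw [hKdiag]; linarith [starHub_offDiag_sum_le hacc hKoff hK hsum h]
  · exact starHub_offDiag_nonneg hW hacc hKoff hhv

/-- **The rows of `K_N` sum to one.** [ours] -/
theorem starHub_rowsum (hKdiag : ∀ h, Kh h h = 1 - ∑ v ∈ univ.erase h, Kh h v) (h : S) : ∑ v, Kh h v = 1 := by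
  rw [← Finset.sum_erase_add univ (fun v => Kh h v) (mem_univ h), hKdiag]; ring

omit [Fintype S] [DecidableEq S] in
/-- **Legality is closed:** from a content present in `N` the chain only moves to contents present in `N`. [ours] -/
theorem starHub_closed (hKoff : ∀ h v, h ≠ v → Kh h v = if N h = 0 then 0 else (N v : ℝ) / K * acc h v) {h v : S} (hh : N h ≠ 0) (hv : N v = 0) :
    Kh h v = 0 := by
  have hhv : h ≠ v := fun e => hh (e ▸ hv)
  rw [hKoff h v hhv, if_neg hh, hv]; simp

/-! ## §2 The one-attempt drift of the hub weight -/

/-- **ONE ATTEMPT MOVES `E θ(hub)` BY AT LEAST `A_h(1−θ_h) − (pW_h/K)·Σ_{v≠h}N_vθ_v`** (`A_h = Σ_{v≠h}K_N(h,v)` the acceptance probability; legal `h`). [ours] -/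
theorem starHub_theta_drift_ge (hW : ∀ v, 0 < W v) (hp0 : 0 ≤ p) (hθ : ∀ v, θ v = 1 / (1 + p * W v)) (hacc : ∀ h v, acc h v = min 1 (W h / W v))
    (hKoff : ∀ h v, h ≠ v → Kh h v = if N h = 0 then 0 else (N v : ℝ) / K * acc h v) (hKdiag : ∀ h, Kh h h = 1 - ∑ v ∈ univ.erase h, Kh h v)
    {h : S} (hh : N h ≠ 0) :
    (∑ v ∈ univ.erase h, Kh h v) * (1 - θ h) - p * W h / K * ∑ v ∈ univ.erase h, (N v : ℝ) * θ v ≤ ∑ v, Kh h v * θ v - θ h := by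
  rw [← Finset.sum_erase_add univ (fun v => Kh h v * θ v) (mem_univ h), hKdiag]
  -- termwise on `v ≠ h`: `Kh h v θ_v ≥ Kh h v − (pW_h/K) N_v θ_v`, i.e. `(N_v/K)acc(1−θ_v) ≤ (N_v/K) pW_h θ_v`
  have hterm : ∀ v ∈ univ.erase h, Kh h v - p * W h / K * ((N v : ℝ) * θ v) ≤ Kh h v * θ v := by
    intro v hv
    rw [hKoff h v (ne_of_mem_erase hv).symm, if_neg hh]
    have hk := starHub_theta_acc_key hW hp0 hθ hacc h v
    have hNK : 0 ≤ (N v : ℝ) / K := div_nonneg (Nat.cast_nonneg _) (Nat.cast_nonneg _)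
    have := mul_le_mul_of_nonneg_left hk hNK
    have e : p * W h / K * ((N v : ℝ) * θ v) = (N v : ℝ) / K * (p * W h * θ v) := by ring
    rw [e]; nlinarith
  have hs := sum_le_sum hterm
  rw [sum_sub_distrib, ← mul_sum] at hs
  nlinarith

/-- The cruder form: `(K_Nθ)(h) − θ_h ≥ −(pW_h/K)·Σ_{v≠h}N_vθ_v`. [ours] -/
theorem starHub_theta_drift_ge' (hW : ∀ v, 0 < W v) (hp0 : 0 ≤ p) (hp : ∀ v, p * W v ≤ 1) (hθ : ∀ v, θ v = 1 / (1 + p * W v))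
    (hacc : ∀ h v, acc h v = min 1 (W h / W v))
    (hKoff : ∀ h v, h ≠ v → Kh h v = if N h = 0 then 0 else (N v : ℝ) / K * acc h v) (hKdiag : ∀ h, Kh h h = 1 - ∑ v ∈ univ.erase h, Kh h v)
    {h : S} (hh : N h ≠ 0) :
    -(p * W h / K * ∑ v ∈ univ.erase h, (N v : ℝ) * θ v) ≤ ∑ v, Kh h v * θ v - θ h := by
  have h1 := starHub_theta_drift_ge hW hp0 hθ hacc hKoff hKdiag hh
  have hA : 0 ≤ ∑ v ∈ univ.erase h, Kh h v := sum_nonneg fun v hv => starHub_offDiag_nonneg hW hacc hKoff (ne_of_mem_erase hv).symm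
  have hθ1 : θ h ≤ 1 := (theta_mem hW hp0 hp hθ h).2
  nlinarith [mul_nonneg hA (sub_nonneg.mpr hθ1)]

/-! ## §3 The one-attempt gain of two copies with a common hub -/

variable {NX NY : S → ℕ} {KX KY : S → S → ℝ}

omit [Fintype S] [DecidableEq S] in
/-- Off the hub content the one-attempt laws differ by `((N_X − N_Y)(w)/K)·acc(z,w)`. [ours] -/
theorem starHub_oneStep_diff (hKX : ∀ h v, h ≠ v → KX h v = if NX h = 0 then 0 else (NX v : ℝ) / K * acc h v)
    (hKY : ∀ h v, h ≠ v → KY h v = if NY h = 0 then 0 else (NY v : ℝ) / K * acc h v) {z w : S} (hzX : NX z ≠ 0) (hzY : NY z ≠ 0) (hw : z ≠ w) :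
    KX z w - KY z w = ((NX w : ℝ) - NY w) / K * acc z w := by
  rw [hKX z w hw, hKY z w hw, if_neg hzX, if_neg hzY]; ring

/-- **THE ONE-ATTEMPT GAIN IN CLOSED FORM.**  With `S_A = Σ_{w≠z, N_Y w<N_X w}(N_X−N_Y)(w)acc(z,w)/K` and `S_B = Σ_{w≠z, N_X w<N_Y w}(N_Y−N_X)(w)acc(z,w)/K`:
`G(K_X(z,·),K_Y(z,·)) = S_A + [z∈A](S_B − S_A)·1 − [z∈C]·(S_A − S_B)⁺`, i.e. `min{S_A,S_B}` (`z ∈ C`), `S_B` (`z ∈ A`), `S_A` (`z ∈ B`). [ours] -/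
theorem starHub_oneStep_gain_eq (hKX : ∀ h v, h ≠ v → KX h v = if NX h = 0 then 0 else (NX v : ℝ) / K * acc h v)
    (hKXd : ∀ h, KX h h = 1 - ∑ v ∈ univ.erase h, KX h v)
    (hKY : ∀ h v, h ≠ v → KY h v = if NY h = 0 then 0 else (NY v : ℝ) / K * acc h v)
    (hKYd : ∀ h, KY h h = 1 - ∑ v ∈ univ.erase h, KY h v) {z : S} (hzX : NX z ≠ 0) (hzY : NY z ≠ 0) :
    ∑ w, KX z w * (if NY w < NX w then (1 : ℝ) else 0) - ∑ w, KY z w * (if NY w < NX w then (1 : ℝ) else 0)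
        - ∑ w, max (KY z w - KX z w) 0 * (if NX w = NY w then (1 : ℝ) else 0)
      = (∑ w ∈ univ.erase z, ((NX w : ℝ) - NY w) / K * acc z w * (if NY w < NX w then (1 : ℝ) else 0))
        + (if NY z < NX z then (1 : ℝ) else 0)
          * ((∑ w ∈ univ.erase z, ((NY w : ℝ) - NX w) / K * acc z w * (if NX w < NY w then (1 : ℝ) else 0))
            - ∑ w ∈ univ.erase z, ((NX w : ℝ) - NY w) / K * acc z w * (if NY w < NX w then (1 : ℝ) else 0))
        - (if NX z = NY z then (1 : ℝ) else 0)
          * max ((∑ w ∈ univ.erase z, ((NX w : ℝ) - NY w) / K * acc z w * (if NY w < NX w then (1 : ℝ) else 0))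
            - ∑ w ∈ univ.erase z, ((NY w : ℝ) - NX w) / K * acc z w * (if NX w < NY w then (1 : ℝ) else 0)) 0 := by
  -- abbreviations
  set SA := ∑ w ∈ univ.erase z, ((NX w : ℝ) - NY w) / K * acc z w * (if NY w < NX w then (1 : ℝ) else 0) with hSA
  set SB := ∑ w ∈ univ.erase z, ((NY w : ℝ) - NX w) / K * acc z w * (if NX w < NY w then (1 : ℝ) else 0) with hSB
  -- the difference on `w ≠ z`
  have hdiff : ∀ w ∈ univ.erase z, KX z w - KY z w = ((NX w : ℝ) - NY w) / K * acc z w :=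
    fun w hw => starHub_oneStep_diff hKX hKY hzX hzY (ne_of_mem_erase hw).symm
  -- the diagonal difference: `KY z z − KX z z = SA − SB`
  have hdiag : KY z z - KX z z = SA - SB := by
    rw [hKXd, hKYd, hSA, hSB]
    have e : ∑ v ∈ univ.erase z, KX z v - ∑ v ∈ univ.erase z, KY z v = ∑ w ∈ univ.erase z, ((NX w : ℝ) - NY w) / K * acc z w := by
      rw [← sum_sub_distrib]; exact sum_congr rfl hdiff
    have e2 : ∑ w ∈ univ.erase z, ((NX w : ℝ) - NY w) / K * acc z w
        = ∑ w ∈ univ.erase z, ((NX w : ℝ) - NY w) / K * acc z w * (if NY w < NX w then (1 : ℝ) else 0)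
          - ∑ w ∈ univ.erase z, ((NY w : ℝ) - NX w) / K * acc z w * (if NX w < NY w then (1 : ℝ) else 0) := by
      rw [← sum_sub_distrib]
      refine sum_congr rfl fun w _ => ?_
      by_cases h1 : NY w < NX w
      · rw [if_pos h1, if_neg (lt_asymm h1)]; ring
      · by_cases h2 : NX w < NY w
        · rw [if_neg h1, if_pos h2]; ring
        · have : NX w = NY w := le_antisymm (not_lt.mp h1) (not_lt.mp h2)
          rw [if_neg h1, if_neg h2, this]; ring
    linarith
  -- first sum: split off `w = z`
  have hA : ∑ w, KX z w * (if NY w < NX w then (1 : ℝ) else 0) - ∑ w, KY z w * (if NY w < NX w then (1 : ℝ) else 0)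
      = SA + (if NY z < NX z then (1 : ℝ) else 0) * (KX z z - KY z z) := by
    rw [← sum_sub_distrib, ← Finset.sum_erase_add univ _ (mem_univ z), hSA]
    have e : ∑ w ∈ univ.erase z, (KX z w * (if NY w < NX w then (1 : ℝ) else 0) - KY z w * (if NY w < NX w then (1 : ℝ) else 0))
        = ∑ w ∈ univ.erase z, ((NX w : ℝ) - NY w) / K * acc z w * (if NY w < NX w then (1 : ℝ) else 0) :=
      sum_congr rfl fun w hw => by rw [← sub_mul, hdiff w hw]
    rw [e]; ring
  -- the `C`-sum: only `w = z` can contribute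
  have hC : ∑ w, max (KY z w - KX z w) 0 * (if NX w = NY w then (1 : ℝ) else 0)
      = (if NX z = NY z then (1 : ℝ) else 0) * max (SA - SB) 0 := by
    rw [← Finset.sum_erase_add univ _ (mem_univ z), hdiag]
    have e : ∑ w ∈ univ.erase z, max (KY z w - KX z w) 0 * (if NX w = NY w then (1 : ℝ) else 0) = 0 := by
      refine sum_eq_zero fun w hw => ?_
      by_cases hc : NX w = NY w
      · have : KY z w - KX z w = 0 := by
          have := hdiff w hw; rw [hc, sub_self, zero_div, zero_mul] at this; linarith
        rw [this]; simp
      · rw [if_neg hc, mul_zero]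
    rw [e, zero_add, mul_comm]
  rw [hA, hC]
  have hdiag' : KX z z - KY z z = SB - SA := by linarith
  rw [hdiag']

/-- **THE ONE-ATTEMPT GAIN IS AT LEAST `pW_z·Δ/K`** (`Δ = Σ_A (N_X − N_Y) = Σ_B (N_Y − N_X)`, equal total masses; legal common hub `z`). [ours] -/
theorem starHub_oneStep_gain_ge (hW : ∀ v, 0 < W v) (hp : ∀ v, p * W v ≤ 1) (hacc : ∀ h v, acc h v = min 1 (W h / W v))
    (hKX : ∀ h v, h ≠ v → KX h v = if NX h = 0 then 0 else (NX v : ℝ) / K * acc h v)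
    (hKXd : ∀ h, KX h h = 1 - ∑ v ∈ univ.erase h, KX h v)
    (hKY : ∀ h v, h ≠ v → KY h v = if NY h = 0 then 0 else (NY v : ℝ) / K * acc h v)
    (hKYd : ∀ h, KY h h = 1 - ∑ v ∈ univ.erase h, KY h v) (hK : 1 ≤ K) {z : S} (hzX : NX z ≠ 0) (hzY : NY z ≠ 0)
    {D : ℝ} (hDA : ∑ w, ((NX w : ℝ) - NY w) * (if NY w < NX w then (1 : ℝ) else 0) = D)
    (hDB : ∑ w, ((NY w : ℝ) - NX w) * (if NX w < NY w then (1 : ℝ) else 0) = D) :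
    p * W z * D / K ≤ ∑ w, KX z w * (if NY w < NX w then (1 : ℝ) else 0) - ∑ w, KY z w * (if NY w < NX w then (1 : ℝ) else 0)
        - ∑ w, max (KY z w - KX z w) 0 * (if NX w = NY w then (1 : ℝ) else 0) := by
  rw [starHub_oneStep_gain_eq hKX hKXd hKY hKYd hzX hzY]
  set SA := ∑ w ∈ univ.erase z, ((NX w : ℝ) - NY w) / K * acc z w * (if NY w < NX w then (1 : ℝ) else 0) with hSA
  set SB := ∑ w ∈ univ.erase z, ((NY w : ℝ) - NX w) / K * acc z w * (if NX w < NY w then (1 : ℝ) else 0) with hSB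
  have hK0 : (0 : ℝ) < K := by exact_mod_cast hK
  have hfl := starHub_acc_ge hW hp hacc z
  -- restricted surplus masses `DA' = Σ_{w≠z, A}`, `DB' = Σ_{w≠z, B}`
  have hSA_ge : p * W z / K * ∑ w ∈ univ.erase z, ((NX w : ℝ) - NY w) * (if NY w < NX w then (1 : ℝ) else 0) ≤ SA := by
    rw [hSA, mul_sum]
    refine sum_le_sum fun w _ => ?_
    by_cases h1 : NY w < NX w
    · have hlt : (NY w : ℝ) < NX w := by exact_mod_cast h1
      have hpos : 0 ≤ ((NX w : ℝ) - NY w) / K := div_nonneg (by linarith) hK0.le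
      rw [if_pos h1, mul_one, mul_one]
      calc p * W z / K * ((NX w : ℝ) - NY w) = ((NX w : ℝ) - NY w) / K * (p * W z) := by ring
        _ ≤ ((NX w : ℝ) - NY w) / K * acc z w := mul_le_mul_of_nonneg_left (hfl w) hpos
    · rw [if_neg h1, mul_zero, mul_zero, mul_zero]
  have hSB_ge : p * W z / K * ∑ w ∈ univ.erase z, ((NY w : ℝ) - NX w) * (if NX w < NY w then (1 : ℝ) else 0) ≤ SB := by
    rw [hSB, mul_sum]
    refine sum_le_sum fun w _ => ?_
    by_cases h1 : NX w < NY w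
    · have hlt : (NX w : ℝ) < NY w := by exact_mod_cast h1
      have hpos : 0 ≤ ((NY w : ℝ) - NX w) / K := div_nonneg (by linarith) hK0.le
      rw [if_pos h1, mul_one, mul_one]
      calc p * W z / K * ((NY w : ℝ) - NX w) = ((NY w : ℝ) - NX w) / K * (p * W z) := by ring
        _ ≤ ((NY w : ℝ) - NX w) / K * acc z w := mul_le_mul_of_nonneg_left (hfl w) hpos
    · rw [if_neg h1, mul_zero, mul_zero, mul_zero]
  -- split `D` at `z`
  have hDA' : ∑ w ∈ univ.erase z, ((NX w : ℝ) - NY w) * (if NY w < NX w then (1 : ℝ) else 0)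
      = D - ((NX z : ℝ) - NY z) * (if NY z < NX z then (1 : ℝ) else 0) := by
    rw [← hDA, ← Finset.sum_erase_add univ _ (mem_univ z)]; ring
  have hDB' : ∑ w ∈ univ.erase z, ((NY w : ℝ) - NX w) * (if NX w < NY w then (1 : ℝ) else 0)
      = D - ((NY z : ℝ) - NX z) * (if NX z < NY z then (1 : ℝ) else 0) := by
    rw [← hDB, ← Finset.sum_erase_add univ _ (mem_univ z)]; ring
  rw [hDA'] at hSA_ge; rw [hDB'] at hSB_ge
  have e : p * W z * D / K = p * W z / K * D := by ring
  rw [e]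
  by_cases hzA : NY z < NX z
  · -- `z ∈ A`: value `SB`, and `B` does not contain `z`
    rw [if_neg (lt_asymm hzA), mul_zero, sub_zero] at hSB_ge
    rw [if_pos hzA, if_neg (ne_of_gt hzA), one_mul, zero_mul, sub_zero]
    linarith
  · by_cases hzB : NX z < NY z
    · -- `z ∈ B`: value `SA`
      rw [if_neg hzA, mul_zero, sub_zero] at hSA_ge
      rw [if_neg hzA, if_neg (ne_of_lt hzB), zero_mul, zero_mul, add_zero, sub_zero]
      exact hSA_ge
    · -- `z ∈ C`: value `min{SA,SB}`
      have hzC : NX z = NY z := le_antisymm (not_lt.mp hzA) (not_lt.mp hzB)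
      rw [if_neg hzA, mul_zero, sub_zero] at hSA_ge
      rw [if_neg hzB, mul_zero, sub_zero] at hSB_ge
      rw [if_neg hzA, if_pos hzC, zero_mul, add_zero, one_mul]
      rcases le_total (SA - SB) 0 with hle | hle
      · rw [max_eq_right hle]; linarith
      · rw [max_eq_left hle]; linarith

end StarHub

end Summit.Ventures.LatticeQCDFlow.Scaling
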